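import Literature.MathematicalPhysics.QuantumFieldTheory.Balaban1983to89.B8Prop5JoinSectELocalRD
import Literature.MathematicalPhysics.QuantumFieldTheory.Balaban1983to89.B8SockHFPRange
import Literature.MathematicalPhysics.QuantumFieldTheory.Balaban1983to89.B8SockLettersRD

/-!
# `Balaban1983to89.B8SockHFPRD` — [Balaban1985RegularSpaces] Prop. 5 p. 94 with Thm 4 p. 88: THE PROPOSITION-5 FIXED-POINT SOCKETS `SockHFP₀`/`SockHFP` FROM THE
# [4]-LETTERS SOCKET WITH THE INVERSE LAWS ON PRINT'S DOMAINS `B8SockLettersRD.SockLettersRD` — `B8SockHFPAssembly` (p451539) / `B8SockHFPOfSockLetters` (p456870) /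
# `B8SockHFPRange` (p463826) re-run with NO total left-inverse law, the right-inverse law of `G′` pointwise on `Ω₀` ([4] Thm 3.1) and `C` in range form ((3.25)); the
# second pass of the W8 junction repair, provider side

statement-level skeleton of published theorems with citation tags; proofs where landed; nothing here is a claim about the
Yang–Mills mass gap

PDF held: `paper:balaban1985-cmp99-regular-spaces-gauge-fixing` (journal page = PDF page + 74); p. 88 (Thm 4, (1.67)–(1.69)), p. 89, pp. 92–97 ((1.92)–(1.106),
Prop. 5, Sect. E).  [4] = [Balaban1985BackgroundPropagators] (Thm 3.1 p. 397, (3.25) p. 394, Thms 3.2–3.3 pp. 397–398).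

WHY THIS FILE (cell `pub-ymgap`, R134 acceleration seat `pub-ymgap-dag-n05-d` (g2), strategy s2 of DAG node N05 = [B8]; dag-lead REBALANCE №56 (a); count-neutral).
Referee dag-ref-A g12's flag W8′ (READ-15, kernel-certified): even with the law of `C` in range form (`SockLettersR`, W8), the letters socket's TOTAL inverse laws of `G′`
(`g_left`, `g_right` on all functions `ℤᵈ → 𝔸`) contradict the displayed Dirichlet range of `G′` at every member with finite `Ω₀` over `ℂ` — so `exists_threshold_sockHFP_pairR`
(p463826) still cannot fire at the cube members.  The socket `SockLettersRD` (this seat) states [4]'s inverse laws on print's domains: no total left-inverse law (the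
existence chain never uses it; unservable even at `Ω₀ = ℤᵈ`, INBOX W8″), the right-inverse law POINTWISE ON `Ω₀`, `C` in range form — jointly satisfiable at finite `Ω₀`.
THIS FILE is the provider side: the two ∃λ-bodies and the three member-level providers re-run VERBATIM on the JOIN `B8Prop5JoinSectELocalRD.hFP_kLevel_of_sectE_local'_RD`
and on `SockLettersRD` — the datum dictionary `B8Prop5SocketDatum` §1–§7, the §0 helpers of `B8SockHFPAssembly`, and the windows `B8SockHFPWindows.hfpWindows_of_guard` BY
NAME, unchanged — plus the one-line implications `SockLettersR → SockLettersRD`, `SockLetters → SockLettersRD`.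

WHAT THIS FILE PROVES (kernel, 0 sorry, theorems only):
* §1 **`sockHFP_body_of_join_RD`**, §2 **`sockHFP₀_body_of_join_RD`** — `B8SockHFPAssembly.sockHFP_body_of_join` / `sockHFP₀_body_of_join` with the letters binder `g_left`
  dropped, `g_right` ↦ `g_rightΩ : ∀ x, ∀ y ∈ Ω 0, (Δ (g x) + qs (Aw (q (g x)))) y = x y`, `c_right` ↦ `c_range` (every other binder and every proof line verbatim);
* §3 `sockLettersRD_of_sockLettersR`, `sockLettersRD_of_sockLetters` (total laws ⇒ laws on print's domains), **`sockHFP_of_sockLettersRD`**, **`sockHFP₀_of_sockLettersRD`** —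
  the sockets at ONE member from `SockLettersRD`, the b9 socket at every level, the geometry laws and a windows family (as `B8SockHFPOfSockLetters` §1);
* §4 **`exists_threshold_sockHFP_pairRD`** — ONE threshold `c_F > 0` for the whole family: at every member with the `ZdIdx` laws + towers at every truncation + index law №8,
  `SockLettersRD … c_L …` + `SB9all` ⇒ `SockHFP₀ … c_F …` ∧ `SockHFP … c_F …` (as p456870/p463826, now with a letters hypothesis servable at finite `Ω₀`).

HONEST SCOPE.  Plumbing by name over landed modules; nothing of Proposition 5's contraction, of [4]'s letters (hypotheses), of [4] Thm 3.3 (the b9 socket is a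
hypothesis) or of Sect. E is proved here beyond composition.  Count-neutral; N05 NOT discharged; one finite T⁴ programme at fixed ε; nothing continuum / ℝ⁴ / OS /
mass-gap / Clay.  Unit `pub-ymgap-dag-n05-d` (g2), 2026-08-26.  No `instance`, no `notation`.
-/


noncomputable section

open NormedSpace
open scoped BigOperators

namespace Literature.MathematicalPhysics.QuantumFieldTheory.Balaban1983to89.B8SockHFPRD

open Complex (I)
open B7Prop1Explicit B7Prop2Explicit B7Prop1Local B7Eq92Concrete
open B7Prop2Explicit (C0 c2')
open B7Prop3Flat (c3)
open B7Prop10General (C6 C4G)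
open B7Prop9Flat (C5')
open B7Eq78Linearization (conjR zdBlocking QprimeIter)
open B8Ineq132 (covDerivFwd covDeriv InAk)
open B8Eq119TwistedAxial (Restr129 InAx bgT)
open B8Eq184Proof (gaugeExp cfgExp)
open B8Eq182Proof (gAd)
open B8Eq188Proof (frakF3)
open B8Lemma1NonAbelian (mulCfg)
open B8Eq140Level (SideTouches sideTouches_mono)
open B8Eq146AExpansion (iEta expCfg)
open B8Ineq130 (tlo thi)
open B8Thm2LogB (blockTop)
open B8Eq138LandauZd (IsLandau138W covDivB covLap QT)
open B8Ineq125Concrete (C2p)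
open B8Eq1117Concrete (XSpace)
open B8Prop3GaugeFixedKLevel (expCfg_iEta_eq_cfgExp)
open B8Eq155JBound (expCfg_iEta_mem_unitaryUnits)
open B8LeafModelZd3 (SockB9P3)
open B8Prop5ContractionKLevel (Bd2 Mc Kc)
open B8LambdaSpaceKLevel (wt)
open B8Prop5Reality (isSelfAdjoint_covDeriv)
open B8Prop5SocketDatum (inAx_congr_of_towers exists_masked_datum grad_bound_of_datum grad_bound_trivial bd2_covDivB_of_grad
  restr129_succ_of_truncation sideTouches_pair_of_mem sideTouches_of_tower_bond h33_of_inAk hP_of_datum h69_of_datum hA_of_datum)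
open B8Prop5JoinSectELocalRD (hFP_kLevel_of_sectE_local'_RD)
open B8SockHFPAssembly (isSelfAdjoint_covDivB covDivB_congr_at frakF3_congr_at mgauge_one_eq inAx_mgauge_expCfg_of_datum)
open B8LeafModelZdOfHFP (SockHFP₀ SockHFP)
open B8LeafModelZdSockLetters (SockLetters)
open B8SockLettersRange (SockLettersR)
open B8SockLettersRD (SockLettersRD)
open B8SockHFPRange (sockLettersR_of_sockLetters)
open B8SockHFPWindows (hfpWindows_of_guard)
open QuantumLattice (blockSites)

-- `Site` alone could resolve to the torus sites of `Setup.lean`; re-export the `ℤ^d` sites of `B7Prop1Explicit`.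
export B7Prop1Explicit (Site)

variable {d : ℕ}

/-! ## §1 THE TRANCHE-2 ASSEMBLY AT ONE LEVEL-`m` DATUM: the ∃λ-body of `SockHFP` from the JOIN + the datum dictionary -/

section Body

variable {𝔸 : Type*} [CStarAlgebra 𝔸] [Nontrivial 𝔸]

/-- **PROPOSITION 5'S FIXED POINT FOR THE LEVEL-`m` DATUM OF THEOREM 4, IN THE SOCKET'S CURRENCY, [4]'s INVERSE LAWS ON PRINT'S DOMAINS — the ∃λ-body of
`B8LeafModelZdOfHFP.SockHFP` assembled from the Sect. D/E JOIN `B8Prop5JoinSectELocalRD.hFP_kLevel_of_sectE_local'_RD`.**  `B8SockHFPAssembly.sockHFP_body_of_join`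
VERBATIM except the letters binders: no `g_left`; `g_rightΩ : ∀ x, ∀ y ∈ Ω₀, (Δ(G′x) + Q′ᵀ𝔄Q′(G′x))(y) = x(y)` ([4] Thm 3.1; dag-ref-A W8′) and
`c_range : ∀ f, Q′G′G′Q′ᵀ(C(Q′f)) = Q′f` ((3.25); W8) in place of the total laws.  SETTING = the antecedents of `SockHFP` at one member
(`K = k` levels, spacing `η`, antitone regions `Ω`, structures `Λs m′`, bond classes `Λb m′` with `hbox`/`hclass`) and one datum: `U₀, U′`
unitary with (1.33)/(1.34) (`InAk`, `InAx` at every truncation) and the box-closeness (1.35)/(1.66) `≤ α₁`; the level-`m` datum (`1 ≤ m < k`)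
`u₁` unitary, `U₁^{u₁} = U′`, (1.29) `Restr129 L m (Λs m) U₀ u₁` (TRUNCATED structure), the Landau condition of record for `U₁`, and
`U₁ = e^{iηA}`, `A` Hermitian, `|A| ≤ c⋆(Lʲη)⁻¹` on the sides of the plaquettes touching `Ω_j`, `j ≤ m` ((1.67)–(1.68), `c⋆ = 5dLB₀(α₀ + α₁)`).
MEMBER GEOMETRY displayed: towers of `Λs (m+1)` inside `Ω_j` (p. 77 «Bʲ(y) ⊂ Ω_j») and INDEX LAW №8 at `m` (`Λs m` is the truncation of
`Λs (m+1)`, p. 89 «we take Λ_{k−1} ∪ B(Λ_k) as Λ_{k−1}»).  IN-EDGE b9: `SockB9P3 … m …` ([4] Thm 3.3 in Prop. 3's frame at level `m`) with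
`α₀, c⋆` below its threshold.  THE [4] LETTERS at `(m + 1, U₀)` — `g Δ q qs Aw c H′` with the projection laws, the readings `hΔ hqs hq hQH`,
(1.92) `hH0 hH1 hH2`, Dirichlet range and reality `hHsupp hHequiv hGsupp hGreal hRreal`, (1.101) `hG`, (1.98) `hRbd` — DISPLAYED exactly as
the JOIN's with `k := m + 1`, `Λs := Λs (m+1)`, `Eb j := {b ∣ SideTouches (Ω j) b}`.  WINDOWS displayed: four of Prop. 3's at
`(α₀, α₂ := c⋆)` (`hside h61 hC₂ hsmall₁`; the others follow from the JOIN's) and the JOIN's scalar windows ONE-FOR-ONE at `αP := α₀`,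
`α₄ := 8B₀′c⋆`, `cB ≥ L·c⋆`, `cA ≥ L·c⋆`, `cDA ≥ d·L²·c⋆`.  CONCLUSION — VERBATIM the ∃λ-body of `SockHFP` at this datum: `λ` Hermitian,
`= 0` off `Ω₀` ((1.109)), (1.108) at `8B₀′c⋆` on the sides touching `Ω_j`, `j ≤ m + 1`, the multiplier form of the Landau equation at
`m + 1` levels, and (1.29) at `m + 1` levels for `u₁·e^{iλ}`.  PROOF: `exists_masked_datum` → the datum binders BY NAME (`B8Prop5SocketDatum`
§1, §3–§7) → the JOIN (BY NAME) at `A′` → transport `A′ ↦ A` on `Ω₀` (`covDivB_congr_at`, `frakF3_congr_at`).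
[cite: Balaban1985RegularSpaces, Prop. 5 (1.106)–(1.109) p.94, Thm 4 p.88, (1.67)–(1.69) p.88, p.89, (1.92)–(1.103) pp.92–93; Balaban1985BackgroundPropagators, Thm 3.1 p.397, (3.25) p.394, Thm 3.3 p.398] -/
theorem sockHFP_body_of_join_RD (hd2 : 2 ≤ d) {L : ℕ} (hL : 2 ≤ L) {η : ℝ} (hη : 0 < η) {k : ℕ}
    -- the member's geometry
    {Ω : ℕ → Set (Site d)} (hΩ : ∀ j, Ω (j + 1) ⊆ Ω j) {Λs : ℕ → ℕ → Set (Site d)} {Λb : ℕ → ℕ → Set (Site d × Fin d)}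
    (hbox : ∀ m, m ≤ k → ∀ j, j ≤ m → ∀ c ∈ Λb m j, ∀ x, InBox (loK L j c.1) (bondHiK L j c.1 c.2) x → x ∈ Ω j)
    (hclass : ∀ m, m ≤ k → ∀ j, j ≤ m → ∀ c ∈ Λb m j,
      (c.1 ∈ Λs m j ∧ c.1 + e c.2 ∈ Λs m j) ∨
      (∃ j', j = j' + 1 ∧ (∀ x, (L : ℤ) • c.1 ≤ x → x ≤ (L : ℤ) • c.1 + blockTop L → x ∈ Λs m j') ∧ c.1 + e c.2 ∈ Λs m j) ∨
      (∃ j', j = j' + 1 ∧ c.1 ∈ Λs m j ∧ (∀ x, (L : ℤ) • (c.1 + e c.2) ≤ x → x ≤ (L : ℤ) • (c.1 + e c.2) + blockTop L → x ∈ Λs m j')))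
    {m : ℕ} (hm1 : 1 ≤ m) (hmk : m < k)
    (htower : ∀ j, j ≤ m + 1 → ∀ y ∈ Λs (m + 1) j, ∀ x, InBox (tlo L y j) (thi L y j) x → x ∈ Ω j)
    (hlt : ∀ j, j < m → Λs m j = Λs (m + 1) j)
    (htop : ∀ x, x ∈ Λs m m ↔ x ∈ Λs (m + 1) m ∨ ∃ y ∈ Λs (m + 1) (m + 1), x ∈ blockSites L y)
    -- the socket's antecedents: constants, (1.33), (1.34), (1.35)/(1.66)
    {α₀ α₁ B₀ B₀' cs α₄ : ℝ} (hα₀ : 0 < α₀) (hα₁ : 0 < α₁) (hB₀ : 0 < B₀) (hB₀' : 0 < B₀')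
    (hcs : cs = 5 * (d : ℝ) * L * B₀ * (α₀ + α₁)) (hα₄ : α₄ = 8 * B₀' * (5 * (d : ℝ) * L * B₀) * (α₀ + α₁))
    {U₀ U' : Site d → Fin d → 𝔸ˣ} (hU₀ : ∀ x κ, U₀ x κ ∈ unitaryUnits 𝔸) (hU' : ∀ x κ, U' x κ ∈ unitaryUnits 𝔸)
    (h33 : InAk L k η α₀ Ω U₀) (h34 : InAk L k η α₀ Ω (mulCfg U' U₀)) (hAx : ∀ m', m' ≤ k → InAx L m' (Λs m') U₀ (mulCfg U' U₀))
    (h135 : ∀ j, j ≤ k → ∀ (z : Site d) (μ : Fin d), (∀ x, InBox (loK L j z) (bondHiK L j z μ) x → x ∈ Ω j) →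
      ‖(avgIter L (mulCfg U' U₀) j z μ : 𝔸) - (avgIter L U₀ j z μ : 𝔸)‖ ≤ α₁)
    -- the datum at level `m`
    {u₁ : Site d → 𝔸ˣ} {U₁ : Site d → Fin d → 𝔸ˣ} {A : Site d → Fin d → 𝔸}
    (hu₁ : ∀ x, u₁ x ∈ unitaryUnits 𝔸) (hW : mgauge U₀ u₁ U₁ = U') (h129 : Restr129 L m (Λs m) U₀ u₁)
    (hLan : IsLandau138W L m η (Ω 0) (Λs m) U₀ U₁)
    (hdat : ∀ j, j ≤ m → ∀ b ∈ {b : Site d × Fin d | SideTouches (Ω j) b.1 b.2},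
      U₁ b.1 b.2 = cfgExp η A b.1 b.2 ∧ IsSelfAdjoint (A b.1 b.2) ∧ ‖A b.1 b.2‖ ≤ cs * ((L : ℝ) ^ j * η)⁻¹)
    -- the b9 socket in Proposition 3's frame AT LEVEL `m`, and its threshold
    {B₀β cB9 β : ℝ} {len : Site d → ℝ} (SB9 : SockB9P3 (𝔸 := 𝔸) L B₀ B₀β cB9 β len η m Ω Λs Λb)
    (hα₀9 : α₀ ≤ cB9) (hcs9 : cs ≤ cB9)
    -- Proposition 3's windows at `(α₀, α₂ := c⋆)` not implied by the JOIN's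
    {C₂ : ℝ} (hside : 36 * d * B₀ * cs ≤ 1 / 2)
    (hC₂ : 8 * (131072 * ((d : ℝ) + 1) ^ 2) * Real.exp (4 * (800 * ((d : ℝ) + 1) ^ 2 * ((d : ℝ) + 4)) * α₀) ≤ C₂)
    (h61 : 2 * cs ^ 2 + 20 * d * α₀ * cs + 2 * C₂ * cs ^ 2 ≤ α₀ + α₁) (hsmall₁ : (d : ℝ) * L * α₁ ≤ 1 / 8)
    -- the [4] LETTERS at `(m + 1, U₀)`, displayed as the JOIN reads them
    (g Δ : (Site d → 𝔸) →ₗ[ℂ] (Site d → 𝔸)) (q : (Site d → 𝔸) →ₗ[ℂ] (ℕ → Site d → 𝔸)) (qs : (ℕ → Site d → 𝔸) →ₗ[ℂ] (Site d → 𝔸))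
    (Aw c : (ℕ → Site d → 𝔸) →ₗ[ℂ] (ℕ → Site d → 𝔸))
    (g_rightΩ : ∀ x, ∀ y ∈ Ω 0, (Δ (g x) + qs (Aw (q (g x)))) y = x y)
    (c_range : ∀ f, q (g (g (qs (c (q f))))) = q f)
    (hΔ : ∀ (f : Site d → 𝔸), ∀ x ∈ Ω 0, Δ f x = covLap η U₀ ((Ω 0).indicator f) x)
    (hqs : ∀ (μ : ℕ → Site d → 𝔸), ∀ x ∈ Ω 0, qs μ x = QT L (m + 1) (Λs (m + 1)) U₀ μ x)
    (hq : ∀ (f : Site d → 𝔸) (j : ℕ), j ≤ m + 1 → ∀ y ∈ Λs (m + 1) j, q f j y = QprimeIter (zdBlocking d L) (bgT L U₀) j f y)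
    (H' : XSpace d (m + 1) 𝔸 →ₗ[ℂ] (Site d → 𝔸)) {B₀'H B₂' BG BR : ℝ} (hB₀'H : 0 < B₀'H) (hB₂' : 0 ≤ B₂') (hBG : 0 ≤ BG) (hBR : 0 ≤ BR)
    (hH0 : ∀ (X : XSpace d (m + 1) 𝔸) (x : Site d), ‖H' X x‖ ≤ B₀'H * ‖X‖)
    (hH1 : ∀ j, j ≤ m + 1 → ∀ (X : XSpace d (m + 1) 𝔸), ∀ p ∈ {b : Site d × Fin d | SideTouches (Ω j) b.1 b.2},
      wt L η j * ‖covDerivFwd η U₀ p.2 (H' X) p.1‖ ≤ B₀'H * ‖X‖)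
    (hH2 : ∀ X : XSpace d (m + 1) 𝔸, Bd2 L η (m + 1) Ω (covLap η U₀ (H' X)) (B₂' * ‖X‖))
    (hHsupp : ∀ (X : XSpace d (m + 1) 𝔸) (x : Site d), x ∉ Ω 0 → H' X x = 0)
    (hHequiv : ∀ X Y : XSpace d (m + 1) 𝔸, (∀ p, Y p = -star (X p)) → ∀ x, H' Y x = -star (H' X x))
    (hQH : ∀ (Y : XSpace d (m + 1) 𝔸) (j : ℕ) (hj : j ≤ m + 1) (y : Site d), y ∈ Λs (m + 1) j →
      QprimeIter (zdBlocking d L) (bgT L U₀) j (H' Y) y = Y (⟨j, Nat.lt_succ_of_le hj⟩, y))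
    (hG : ∀ (f : Site d → 𝔸) (r : ℝ), 0 ≤ r → Bd2 L η (m + 1) Ω f r →
      (∀ x, ‖g f x‖ ≤ BG * r) ∧ ∀ j, j ≤ m + 1 → ∀ p ∈ {b : Site d × Fin d | SideTouches (Ω j) b.1 b.2},
        wt L η j * ‖covDerivFwd η U₀ p.2 (g f) p.1‖ ≤ BG * r)
    (hGsupp : ∀ (f : Site d → 𝔸) (x : Site d), x ∉ Ω 0 → g f x = 0)
    (hGreal : ∀ f : Site d → 𝔸, (∀ j, j ≤ m + 1 → ∀ x ∈ Ω j, IsSelfAdjoint (f x)) → ∀ x, IsSelfAdjoint (g f x))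
    (hRbd : ∀ (f : Site d → 𝔸) (r : ℝ), 0 ≤ r → Bd2 L η (m + 1) Ω f r → Bd2 L η (m + 1) Ω (f - g (qs (c (q (g f))))) (BR * r))
    (hRreal : ∀ f : Site d → 𝔸, (∀ j, j ≤ m + 1 → ∀ x ∈ Ω j, IsSelfAdjoint (f x)) →
      ∀ j, j ≤ m + 1 → ∀ x ∈ Ω j, IsSelfAdjoint ((f - g (qs (c (q (g f))))) x))
    -- the JOIN's scalar windows, one-for-one (`αP := α₀`, `α₄ := 8B₀′c⋆`; `cB cA cDA` free above their datum values)
    {cB cA cDA : ℝ} (hcBlo : L * cs ≤ cB) (hcAlo : L * cs ≤ cA) (hcDAlo : (d : ℝ) * (L : ℝ) ^ 2 * cs ≤ cDA)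
    (hα3 : C0 d * α₀ ≤ 1 / 3) (hα4 : 4 * α₀ ≤ c2' d L)
    (hsmall : Real.exp (4 * (800 * ((d : ℝ) + 1) ^ 2 * ((d : ℝ) + 4)) * α₀) * (1 + 8 * (131072 * ((d : ℝ) + 1) ^ 2) * cB) ≤ 2)
    (hc₃ : 2 * cB ≤ c3 d L) (hsc : 2048 * (d : ℝ) * cB ≤ 1) (hα₃' : 40 * d * cB ≤ 1 / 200)
    (hs₁ : 200 * C6 d * (2 * α₄) ≤ 1) (hs₂ : 12000 * ((d : ℝ) + 1) * L * (2 * α₄) ≤ 1)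
    (hs₃ : C4G d L * (α₀ + 40 * d * cB + 4 * (2 * α₄)) ≤ 1)
    (hs₄ : 1024 * ((d : ℝ) + 1) * ((d : ℝ) + 4) * L ^ 2 * α₀ ≤ 1) (hs₅ : 32 * ((d : ℝ) + 1) ^ 2 * C6 d * L ^ 2 * α₀ ≤ 1)
    (hs₆ : 16 * d * C5' d * C6 d * (L : ℝ) ^ 2 * α₀ ≤ 1) (hs₇ : 8 * d * C6 d * L * α₀ ≤ 1)
    (hsm : 40 * d * cB + α₄ ≤ 1 / (4 * B₀'H * (2 * C2p d))) (hprod8 : 2 * C6 d * (40 * d * cB + 4 * α₄) ≤ 1 / 8)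
    {hE hE₂ lE lE₂ : ℝ} (hE_def : hE = B₀'H * (C2p d * (40 * d * cB + α₄) * α₄)) (hE₂_def : hE₂ = B₂' * (C2p d * (40 * d * cB + α₄) * α₄))
    (lE_def : lE = B₀'H * (4 * C2p d * (40 * d * cB + 2 * α₄))) (lE₂_def : lE₂ = B₂' * (4 * C2p d * (40 * d * cB + 2 * α₄)))
    (hcA' : cA ≤ 1 / 13) (ha₁' : α₄ / 4 + hE ≤ 1 / 24) (hb₁' : α₄ / 4 + hE ≤ 1 / 140) (hθ : 10 * (α₄ / 4 + hE) * BR ≤ 1 / 2)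
    (h103 : BG * Mc d BR (α₄ / 4 + hE) cA hE₂ cDA ≤ α₄ / 4)
    (h106 : BG * Kc d BR (α₄ / 4 + hE) cA hE₂ cDA lE₂ (1 + lE) (1 + lE) ≤ 1 / 2) :
    ∃ lam : Site d → 𝔸, (∀ x, IsSelfAdjoint (lam x)) ∧ (∀ x, x ∉ Ω 0 → lam x = 0) ∧
      (∀ j, j ≤ m + 1 → ∀ b ∈ {b : Site d × Fin d | SideTouches (Ω j) b.1 b.2},
        ‖lam b.1‖ ≤ α₄ ∧ ((L : ℝ) ^ j * η) * ‖covDerivFwd η U₀ b.2 lam b.1‖ ≤ α₄) ∧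
      (∃ μ : ℕ → Site d → 𝔸, ∀ x ∈ Ω 0,
        covLap η U₀ ((Ω 0).indicator fun y => covDivB η U₀ A y + covLap η U₀ lam y +
          ((conjR (gaugeExp lam y)⁻¹ (covDivB η U₀ A y) - covDivB η U₀ A y) +
            (gAd (covLap η U₀ lam y) (lam y) - covLap η U₀ lam y) + ∑ μ, frakF3 η U₀ lam A y μ)) x =
          QT L (m + 1) (Λs (m + 1)) U₀ μ x) ∧
      Restr129 L (m + 1) (Λs (m + 1)) U₀ (u₁ * gaugeExp lam) := by
  subst hcs
  have hL1 : 1 ≤ L := le_trans (by norm_num) hL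
  have hd1 : 1 ≤ d := le_trans (by norm_num) hd2
  have hLr : (1 : ℝ) ≤ L := by exact_mod_cast hL1
  have hmK : m + 1 ≤ k := hmk
  have hsum : 0 < α₀ + α₁ := add_pos hα₀ hα₁
  have hcs0 : 0 ≤ 5 * (d : ℝ) * L * B₀ * (α₀ + α₁) := by positivity
  have hcspos : 0 < 5 * (d : ℝ) * L * B₀ * (α₀ + α₁) := by positivity
  have hα₄pos : 0 < α₄ := by rw [hα₄]; positivity
  -- `c⋆ ≤ L·c⋆ ≤ cB`, hence Prop. 3's remaining windows from the JOIN's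
  have hcsB : 5 * (d : ℝ) * L * B₀ * (α₀ + α₁) ≤ cB := (le_mul_of_one_le_left hcs0 hLr).trans hcBlo
  have hcB0 : 0 ≤ cB := hcs0.trans hcsB
  have hcA0 : 0 ≤ cA := (hcs0.trans (le_mul_of_one_le_left hcs0 hLr)).trans hcAlo
  have hcDA0 : 0 ≤ cDA := le_trans (by positivity) hcDAlo
  have hd0 : (1 : ℝ) ≤ d := by exact_mod_cast hd1
  have hcBsmall : (d : ℝ) * cB ≤ 1 / 8000 := by linarith only [hα₃']
  have hdcs : (d : ℝ) * (5 * (d : ℝ) * L * B₀ * (α₀ + α₁)) ≤ 1 / 8000 :=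
    (mul_le_mul_of_nonneg_left hcsB (by positivity)).trans hcBsmall
  have hcs8000 : 5 * (d : ℝ) * L * B₀ * (α₀ + α₁) ≤ 1 / 8000 := (le_mul_of_one_le_left hcs0 hd0).trans hdcs
  have h16 : 16 * (5 * (d : ℝ) * L * B₀ * (α₀ + α₁)) ≤ 1 := by linarith only [hcs8000]
  have h50 : 50 * d * (5 * (d : ℝ) * L * B₀ * (α₀ + α₁)) ≤ 1 := by linarith only [hdcs]
  have hd5 : 5 * (5 * (d : ℝ) * L * B₀ * (α₀ + α₁)) * ((d : ℝ) - 1) ≤ 4 := by nlinarith only [hdcs, hcs0]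
  have hc₃3 : 2 * (5 * (d : ℝ) * L * B₀ * (α₀ + α₁)) ≤ c3 d L := by linarith only [hc₃, hcsB]
  have hsmall3 : Real.exp (4 * (800 * ((d : ℝ) + 1) ^ 2 * ((d : ℝ) + 4)) * α₀) *
      (1 + 8 * (131072 * ((d : ℝ) + 1) ^ 2) * (5 * (d : ℝ) * L * B₀ * (α₀ + α₁))) ≤ 2 := by
    refine le_trans (mul_le_mul_of_nonneg_left ?_ (Real.exp_pos _).le) hsmall
    have h := mul_le_mul_of_nonneg_left hcsB (show (0 : ℝ) ≤ 8 * (131072 * ((d : ℝ) + 1) ^ 2) by positivity)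
    linarith only [h]
  have hαP2 : 2 * α₀ ≤ c2' d L := by linarith only [hα4, hα₀]
  -- the MASKED exponent `A′` of the datum (globally Hermitian, `= A` on the touched bonds)
  obtain ⟨A', hsa, hagree, hWA, hA0⟩ := exists_masked_datum hdat
  have hWA1 : ∀ j, j ≤ m → ∀ (y : Site d) (τ : Fin d), SideTouches (Ω j) y τ → U₁ y τ = cfgExp η A' y τ :=
    fun j hj y τ hs => (hWA j hj y τ hs).1
  have h41 : ∀ j, j ≤ m → ∀ (y : Site d) (τ : Fin d), SideTouches (Ω j) y τ →
      ‖A' y τ‖ ≤ (5 * (d : ℝ) * L * B₀ * (α₀ + α₁)) * ((L : ℝ) ^ j * η)⁻¹ := fun j hj y τ hs => (hWA j hj y τ hs).2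
  -- the JOIN's datum binders BY NAME (`B8Prop5SocketDatum` §7, §1, §5)
  have h33' := h33_of_inAk hL1 hα₀ h33 hmK htower
  have hP' := hP_of_datum hL1 hα₀ hΩ h34 hmK htower hu₁ hW hWA1
  have h69' : ∀ j, j ≤ m + 1 → ∀ y ∈ Λs (m + 1) j, ∀ (x : Site d) (κ : Fin d), InBox (tlo L y j) (thi L y j) x →
      InBox (tlo L y j) (thi L y j) (x + e κ) → ‖iEta η A' x κ‖ ≤ cB * ((L : ℝ) ^ j)⁻¹ :=
    fun j hj y hy x κ hx hxe =>
      (h69_of_datum hd2 hL1 hη hΩ htower hcs0 h41 j hj y hy x κ hx hxe).trans (mul_le_mul_of_nonneg_right hcBlo (by positivity))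
  have hA' : ∀ j, j ≤ m + 1 → ∀ x ∈ Ω j, ∀ μ : Fin d,
      wt L η j * ‖A' x μ‖ ≤ cA ∧ wt L η j * ‖conjR (U₀ (x - e μ) μ)⁻¹ (A' (x - e μ) μ)‖ ≤ cA := fun j hj x hx μ =>
    ⟨(hA_of_datum hd2 hL1 hη hΩ hU₀ hcs0 h41 j hj x hx μ).1.trans hcAlo, (hA_of_datum hd2 hL1 hη hΩ hU₀ hcs0 h41 j hj x hx μ).2.trans hcAlo⟩
  have hBu : ∀ (x : Site d) (κ : Fin d), expCfg (iEta η A') x κ ∈ unitaryUnits 𝔸 := expCfg_iEta_mem_unitaryUnits η hsa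
  have hAx' : InAx L (m + 1) (Λs (m + 1)) U₀ (mgauge U₀ u₁ (expCfg (iEta η A')) * U₀) :=
    inAx_mgauge_expCfg_of_datum hd2 hL1 hΩ htower hW hWA1 (hAx (m + 1) hmK)
  have h129' : Restr129 L (m + 1) (Λs (m + 1)) U₀ u₁ := restr129_succ_of_truncation hL1 hlt htop h129
  -- the source `D*A′`: (1.69)'s gradient member by Prop. 3 at level `m` (§3), then `|D*A′|₍₋₂₎ ≤ d·L²·c⋆ ≤ cDA` (§4); Hermitian
  have hgrad := grad_bound_of_datum hd2 hη hL k hU₀ hU' hα₀ hα₁ hcspos hB₀.le hα3 hα4 h16 hd5 hsmall3 hc₃3 hside h50 hC₂ h61 hsmall₁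
    Ω hΩ Λs Λb hbox hclass h33 h34 hAx h135 hm1 hmk.le SB9 hα₀9 hcs9 hu₁ hW h129 hLan hsa hWA hA0
  have hDA : Bd2 L η (m + 1) Ω (fun y => covDivB η U₀ A' y) cDA := fun j hj x hx =>
    (bd2_covDivB_of_grad hd2 hL1 hη hΩ hU₀ hcs0 hgrad j hj x hx).trans hcDAlo
  have hDAsa : ∀ j, j ≤ m + 1 → ∀ x ∈ Ω j, IsSelfAdjoint (covDivB η U₀ A' x) := fun j _ x _ => isSelfAdjoint_covDivB hU₀ hsa x
  -- the JOIN's bond classes `Eb j := {b ∣ SideTouches (Ω j) b}` (§6)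
  have hEbΩ : ∀ j, j ≤ m + 1 → ∀ x ∈ Ω j, ∀ μ : Fin d, (x, μ) ∈ {b : Site d × Fin d | SideTouches (Ω j) b.1 b.2} ∧
      (x - e μ, μ) ∈ {b : Site d × Fin d | SideTouches (Ω j) b.1 b.2} := fun j _ x hx μ => sideTouches_pair_of_mem hd2 hx μ
  have hEbT : ∀ j, j ≤ m + 1 → ∀ y ∈ Λs (m + 1) j, ∀ (x : Site d) (κ : Fin d), InBox (tlo L y j) (thi L y j) x →
      InBox (tlo L y j) (thi L y j) (x + e κ) → (x, κ) ∈ {b : Site d × Fin d | SideTouches (Ω j) b.1 b.2} :=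
    fun j hj y hy x κ hx _ => sideTouches_of_tower_bond hd2 htower hj hy x κ hx
  -- THE JOIN WITH THE LAWS ON PRINT'S DOMAINS (`hFP_kLevel_of_sectE_local'_RD`, BY NAME) at `k := m + 1`, `Λs := Λs (m+1)`, `B := iηA′`, `αP := α₀`
  obtain ⟨lam, hlsa, hloff, h108, ⟨μ, hmul⟩, h129''⟩ := hFP_kLevel_of_sectE_local'_RD (k := m + 1) (Λs := Λs (m + 1))
    (Eb := fun j => {b : Site d × Fin d | SideTouches (Ω j) b.1 b.2}) (u₁ := u₁) (A := A') hL hη hU₀ hEbΩ hEbT g Δ q qs Aw c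
    g_rightΩ c_range hΔ hqs hq H' hα₀ hα3 hα4 hcB0 hα₄pos hB₀'H hB₂' h33' h69' hd1 hα₀ hα3 hαP2 hBu hP' hAx' h129' hH0 hH1 hH2 hHsupp
    hHequiv hQH hsmall hc₃ hsc hα₃' hs₁ hs₂ hs₃ hs₄ hs₅ hs₆ hs₇ hsm hprod8 hE_def hE₂_def lE_def lE₂_def hBG hBR hcA0 hcA' hcDA0 ha₁' hb₁'
    hθ hG hGsupp hGreal hRbd hRreal hDA hDAsa hA' hsa h103 h106
  refine ⟨lam, hlsa, hloff, fun j hj b hb => h108 j hj b hb, ⟨μ, fun x hx => ?_⟩, h129''⟩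
  -- transport the multiplier clause from `A′` back to `A`: the two agree on the bonds read on `Ω₀`
  have hind : ((Ω 0).indicator fun y => covDivB η U₀ A y + covLap η U₀ lam y +
        ((conjR (gaugeExp lam y)⁻¹ (covDivB η U₀ A y) - covDivB η U₀ A y) +
          (gAd (covLap η U₀ lam y) (lam y) - covLap η U₀ lam y) + ∑ μ, frakF3 η U₀ lam A y μ)) =
      ((Ω 0).indicator fun y => covDivB η U₀ A' y + covLap η U₀ lam y +
        ((conjR (gaugeExp lam y)⁻¹ (covDivB η U₀ A' y) - covDivB η U₀ A' y) +
          (gAd (covLap η U₀ lam y) (lam y) - covLap η U₀ lam y) + ∑ μ, frakF3 η U₀ lam A' y μ)) := by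
    refine Set.indicator_congr fun y hy => ?_
    have h₁ : ∀ ν : Fin d, A' y ν = A y ν := fun ν => hagree 0 (Nat.zero_le _) y ν (sideTouches_pair_of_mem hd2 hy ν).1
    have h₂ : ∀ ν : Fin d, A' (y - e ν) ν = A (y - e ν) ν := fun ν => hagree 0 (Nat.zero_le _) (y - e ν) ν (sideTouches_pair_of_mem hd2 hy ν).2
    have h₃ : ∀ ν : Fin d, frakF3 η U₀ lam A' y ν = frakF3 η U₀ lam A y ν := fun ν => frakF3_congr_at η U₀ lam (h₁ ν) (h₂ ν)
    simp only [covDivB_congr_at η U₀ h₁ h₂, h₃]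
  rw [hind]
  exact hmul x hx

end Body


/-! ## §2 THE SAME AT THE BASE DATUM `u₁ = 1`, `U₁ = U′` (p. 89): the ∃λ-body of `SockHFP₀` from the JOIN at one level -/

section Base

variable {𝔸 : Type*} [CStarAlgebra 𝔸] [Nontrivial 𝔸]

/-- **PROPOSITION 5'S FIXED POINT FOR THE BASE DATUM OF THEOREM 4, [4]'s INVERSE LAWS ON PRINT'S DOMAINS — the ∃λ-body of `B8LeafModelZdOfHFP.SockHFP₀` assembled from
the JOIN `hFP_kLevel_of_sectE_local'_RD` at ONE level.**  `B8SockHFPAssembly.sockHFP₀_body_of_join` VERBATIM except the letters binders (no `g_left`; `g_rightΩ`, `c_range`;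
dag-ref-A W8/W8′).  The base datum (p. 89: «for k = 0 … u₁ = 1, U₁ = U′»): `U′ = e^{iηA}`, `A` Hermitian, `|A| ≤ c⋆η⁻¹` on the sides of the plaquettes
touching `Ω₀`; the JOIN runs at `k := 1` for `Λs 1` with `u₁ := 1` ((1.29) for `1` by `B8Thm4TruncationLocal.restr129_one`, `U^{1} = U`), the
source bound from the WEIGHT-FREE gradient bound `η²|∇A′| ≤ 2c⋆` (`B8Prop5SocketDatum.grad_bound_trivial` — no Proposition 3, no b9 socket at
level `0`), whence `cDA ≥ 2·d·L²·c⋆`; everything else as `sockHFP_body_of_join_RD` with `m + 1 = 1` (towers of `Λs 1` inside `Ω_j`, the [4]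
LETTERS at `(1, U₀)`, the JOIN's windows one-for-one).  CONCLUSION — VERBATIM the ∃λ-body of `SockHFP₀`.
[cite: Balaban1985RegularSpaces, Prop. 5 (1.106)–(1.109) p.94, p.89 (the start of the induction), (1.66) p.88, (1.92)–(1.103) pp.92–93] -/
theorem sockHFP₀_body_of_join_RD (hd2 : 2 ≤ d) {L : ℕ} (hL : 2 ≤ L) {η : ℝ} (hη : 0 < η) {k : ℕ} (hk : 1 ≤ k)
    -- the member's geometry
    {Ω : ℕ → Set (Site d)} (hΩ : ∀ j, Ω (j + 1) ⊆ Ω j) {Λs : ℕ → ℕ → Set (Site d)}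
    (htower : ∀ j, j ≤ 1 → ∀ y ∈ Λs 1 j, ∀ x, InBox (tlo L y j) (thi L y j) x → x ∈ Ω j)
    -- the socket's antecedents: constants, (1.33), (1.34)
    {α₀ α₁ B₀ B₀' cs α₄ : ℝ} (hα₀ : 0 < α₀) (hα₁ : 0 < α₁) (hB₀ : 0 < B₀) (hB₀' : 0 < B₀')
    (hcs : cs = 5 * (d : ℝ) * L * B₀ * (α₀ + α₁)) (hα₄ : α₄ = 8 * B₀' * (5 * (d : ℝ) * L * B₀) * (α₀ + α₁))
    {U₀ U' : Site d → Fin d → 𝔸ˣ} (hU₀ : ∀ x κ, U₀ x κ ∈ unitaryUnits 𝔸)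
    (h33 : InAk L k η α₀ Ω U₀) (h34 : InAk L k η α₀ Ω (mulCfg U' U₀)) (hAx : ∀ m', m' ≤ k → InAx L m' (Λs m') U₀ (mulCfg U' U₀))
    -- the base datum
    {A : Site d → Fin d → 𝔸}
    (hdat : ∀ j, j ≤ 0 → ∀ b ∈ {b : Site d × Fin d | SideTouches (Ω j) b.1 b.2},
      U' b.1 b.2 = cfgExp η A b.1 b.2 ∧ IsSelfAdjoint (A b.1 b.2) ∧ ‖A b.1 b.2‖ ≤ cs * ((L : ℝ) ^ j * η)⁻¹)
    -- the [4] LETTERS at `(1, U₀)`, displayed as the JOIN reads them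
    (g Δ : (Site d → 𝔸) →ₗ[ℂ] (Site d → 𝔸)) (q : (Site d → 𝔸) →ₗ[ℂ] (ℕ → Site d → 𝔸)) (qs : (ℕ → Site d → 𝔸) →ₗ[ℂ] (Site d → 𝔸))
    (Aw c : (ℕ → Site d → 𝔸) →ₗ[ℂ] (ℕ → Site d → 𝔸))
    (g_rightΩ : ∀ x, ∀ y ∈ Ω 0, (Δ (g x) + qs (Aw (q (g x)))) y = x y)
    (c_range : ∀ f, q (g (g (qs (c (q f))))) = q f)
    (hΔ : ∀ (f : Site d → 𝔸), ∀ x ∈ Ω 0, Δ f x = covLap η U₀ ((Ω 0).indicator f) x)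
    (hqs : ∀ (μ : ℕ → Site d → 𝔸), ∀ x ∈ Ω 0, qs μ x = QT L 1 (Λs 1) U₀ μ x)
    (hq : ∀ (f : Site d → 𝔸) (j : ℕ), j ≤ 1 → ∀ y ∈ Λs 1 j, q f j y = QprimeIter (zdBlocking d L) (bgT L U₀) j f y)
    (H' : XSpace d 1 𝔸 →ₗ[ℂ] (Site d → 𝔸)) {B₀'H B₂' BG BR : ℝ} (hB₀'H : 0 < B₀'H) (hB₂' : 0 ≤ B₂') (hBG : 0 ≤ BG) (hBR : 0 ≤ BR)
    (hH0 : ∀ (X : XSpace d 1 𝔸) (x : Site d), ‖H' X x‖ ≤ B₀'H * ‖X‖)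
    (hH1 : ∀ j, j ≤ 1 → ∀ (X : XSpace d 1 𝔸), ∀ p ∈ {b : Site d × Fin d | SideTouches (Ω j) b.1 b.2},
      wt L η j * ‖covDerivFwd η U₀ p.2 (H' X) p.1‖ ≤ B₀'H * ‖X‖)
    (hH2 : ∀ X : XSpace d 1 𝔸, Bd2 L η 1 Ω (covLap η U₀ (H' X)) (B₂' * ‖X‖))
    (hHsupp : ∀ (X : XSpace d 1 𝔸) (x : Site d), x ∉ Ω 0 → H' X x = 0)
    (hHequiv : ∀ X Y : XSpace d 1 𝔸, (∀ p, Y p = -star (X p)) → ∀ x, H' Y x = -star (H' X x))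
    (hQH : ∀ (Y : XSpace d 1 𝔸) (j : ℕ) (hj : j ≤ 1) (y : Site d), y ∈ Λs 1 j →
      QprimeIter (zdBlocking d L) (bgT L U₀) j (H' Y) y = Y (⟨j, Nat.lt_succ_of_le hj⟩, y))
    (hG : ∀ (f : Site d → 𝔸) (r : ℝ), 0 ≤ r → Bd2 L η 1 Ω f r →
      (∀ x, ‖g f x‖ ≤ BG * r) ∧ ∀ j, j ≤ 1 → ∀ p ∈ {b : Site d × Fin d | SideTouches (Ω j) b.1 b.2},
        wt L η j * ‖covDerivFwd η U₀ p.2 (g f) p.1‖ ≤ BG * r)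
    (hGsupp : ∀ (f : Site d → 𝔸) (x : Site d), x ∉ Ω 0 → g f x = 0)
    (hGreal : ∀ f : Site d → 𝔸, (∀ j, j ≤ 1 → ∀ x ∈ Ω j, IsSelfAdjoint (f x)) → ∀ x, IsSelfAdjoint (g f x))
    (hRbd : ∀ (f : Site d → 𝔸) (r : ℝ), 0 ≤ r → Bd2 L η 1 Ω f r → Bd2 L η 1 Ω (f - g (qs (c (q (g f))))) (BR * r))
    (hRreal : ∀ f : Site d → 𝔸, (∀ j, j ≤ 1 → ∀ x ∈ Ω j, IsSelfAdjoint (f x)) →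
      ∀ j, j ≤ 1 → ∀ x ∈ Ω j, IsSelfAdjoint ((f - g (qs (c (q (g f))))) x))
    -- the JOIN's scalar windows, one-for-one (`αP := α₀`, `α₄ := 8B₀′c⋆`; `cB cA cDA` free above their datum values, `cDA ≥ 2dL²c⋆` here)
    {cB cA cDA : ℝ} (hcBlo : L * cs ≤ cB) (hcAlo : L * cs ≤ cA) (hcDAlo : 2 * (d : ℝ) * (L : ℝ) ^ 2 * cs ≤ cDA)
    (hα3 : C0 d * α₀ ≤ 1 / 3) (hα4 : 4 * α₀ ≤ c2' d L)
    (hsmall : Real.exp (4 * (800 * ((d : ℝ) + 1) ^ 2 * ((d : ℝ) + 4)) * α₀) * (1 + 8 * (131072 * ((d : ℝ) + 1) ^ 2) * cB) ≤ 2)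
    (hc₃ : 2 * cB ≤ c3 d L) (hsc : 2048 * (d : ℝ) * cB ≤ 1) (hα₃' : 40 * d * cB ≤ 1 / 200)
    (hs₁ : 200 * C6 d * (2 * α₄) ≤ 1) (hs₂ : 12000 * ((d : ℝ) + 1) * L * (2 * α₄) ≤ 1)
    (hs₃ : C4G d L * (α₀ + 40 * d * cB + 4 * (2 * α₄)) ≤ 1)
    (hs₄ : 1024 * ((d : ℝ) + 1) * ((d : ℝ) + 4) * L ^ 2 * α₀ ≤ 1) (hs₅ : 32 * ((d : ℝ) + 1) ^ 2 * C6 d * L ^ 2 * α₀ ≤ 1)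
    (hs₆ : 16 * d * C5' d * C6 d * (L : ℝ) ^ 2 * α₀ ≤ 1) (hs₇ : 8 * d * C6 d * L * α₀ ≤ 1)
    (hsm : 40 * d * cB + α₄ ≤ 1 / (4 * B₀'H * (2 * C2p d))) (hprod8 : 2 * C6 d * (40 * d * cB + 4 * α₄) ≤ 1 / 8)
    {hE hE₂ lE lE₂ : ℝ} (hE_def : hE = B₀'H * (C2p d * (40 * d * cB + α₄) * α₄)) (hE₂_def : hE₂ = B₂' * (C2p d * (40 * d * cB + α₄) * α₄))
    (lE_def : lE = B₀'H * (4 * C2p d * (40 * d * cB + 2 * α₄))) (lE₂_def : lE₂ = B₂' * (4 * C2p d * (40 * d * cB + 2 * α₄)))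
    (hcA' : cA ≤ 1 / 13) (ha₁' : α₄ / 4 + hE ≤ 1 / 24) (hb₁' : α₄ / 4 + hE ≤ 1 / 140) (hθ : 10 * (α₄ / 4 + hE) * BR ≤ 1 / 2)
    (h103 : BG * Mc d BR (α₄ / 4 + hE) cA hE₂ cDA ≤ α₄ / 4)
    (h106 : BG * Kc d BR (α₄ / 4 + hE) cA hE₂ cDA lE₂ (1 + lE) (1 + lE) ≤ 1 / 2) :
    ∃ lam : Site d → 𝔸, (∀ x, IsSelfAdjoint (lam x)) ∧ (∀ x, x ∉ Ω 0 → lam x = 0) ∧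
      (∀ j, j ≤ 1 → ∀ b ∈ {b : Site d × Fin d | SideTouches (Ω j) b.1 b.2},
        ‖lam b.1‖ ≤ α₄ ∧ ((L : ℝ) ^ j * η) * ‖covDerivFwd η U₀ b.2 lam b.1‖ ≤ α₄) ∧
      (∃ μ : ℕ → Site d → 𝔸, ∀ x ∈ Ω 0,
        covLap η U₀ ((Ω 0).indicator fun y => covDivB η U₀ A y + covLap η U₀ lam y +
          ((conjR (gaugeExp lam y)⁻¹ (covDivB η U₀ A y) - covDivB η U₀ A y) +
            (gAd (covLap η U₀ lam y) (lam y) - covLap η U₀ lam y) + ∑ μ, frakF3 η U₀ lam A y μ)) x =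
          QT L 1 (Λs 1) U₀ μ x) ∧
      Restr129 L 1 (Λs 1) U₀ ((1 : Site d → 𝔸ˣ) * gaugeExp lam) := by
  subst hcs
  have hL1 : 1 ≤ L := le_trans (by norm_num) hL
  have hd1 : 1 ≤ d := le_trans (by norm_num) hd2
  have hLr : (1 : ℝ) ≤ L := by exact_mod_cast hL1
  have hk1 : 0 + 1 ≤ k := hk
  have hsum : 0 < α₀ + α₁ := add_pos hα₀ hα₁
  have hcs0 : 0 ≤ 5 * (d : ℝ) * L * B₀ * (α₀ + α₁) := by positivity
  have hα₄pos : 0 < α₄ := by rw [hα₄]; positivity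
  have hcB0 : 0 ≤ cB := (hcs0.trans (le_mul_of_one_le_left hcs0 hLr)).trans hcBlo
  have hcA0 : 0 ≤ cA := (hcs0.trans (le_mul_of_one_le_left hcs0 hLr)).trans hcAlo
  have hcDA0 : 0 ≤ cDA := le_trans (by positivity) hcDAlo
  have hαP2 : 2 * α₀ ≤ c2' d L := by linarith only [hα4, hα₀]
  -- the MASKED exponent `A′` of the base datum (globally Hermitian, `= A` on the sides touching `Ω₀`)
  obtain ⟨A', hsa, hagree, hWA, hA0⟩ := exists_masked_datum hdat
  have hWA1 : ∀ j, j ≤ 0 → ∀ (y : Site d) (τ : Fin d), SideTouches (Ω j) y τ → U' y τ = cfgExp η A' y τ :=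
    fun j hj y τ hs => (hWA j hj y τ hs).1
  have h41 : ∀ j, j ≤ 0 → ∀ (y : Site d) (τ : Fin d), SideTouches (Ω j) y τ →
      ‖A' y τ‖ ≤ (5 * (d : ℝ) * L * B₀ * (α₀ + α₁)) * ((L : ℝ) ^ j * η)⁻¹ := fun j hj y τ hs => (hWA j hj y τ hs).2
  -- the base datum `u₁ = 1`, `U₁ = U′`
  have hone : mgauge U₀ (1 : Site d → 𝔸ˣ) U' = U' := mgauge_one_eq U₀ U'
  have hu1 : ∀ x, (1 : Site d → 𝔸ˣ) x ∈ unitaryUnits 𝔸 := fun _ => (unitaryUnits 𝔸).one_mem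
  -- the JOIN's datum binders BY NAME (`B8Prop5SocketDatum` §7, §1; `restr129_one`)
  have h33' := h33_of_inAk (m := 0) hL1 hα₀ h33 hk1 htower
  have hP' := hP_of_datum (m := 0) hL1 hα₀ hΩ h34 hk1 htower hu1 hone hWA1
  have h69' : ∀ j, j ≤ 1 → ∀ y ∈ Λs 1 j, ∀ (x : Site d) (κ : Fin d), InBox (tlo L y j) (thi L y j) x →
      InBox (tlo L y j) (thi L y j) (x + e κ) → ‖iEta η A' x κ‖ ≤ cB * ((L : ℝ) ^ j)⁻¹ :=
    fun j hj y hy x κ hx hxe =>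
      (h69_of_datum (m := 0) hd2 hL1 hη hΩ htower hcs0 h41 j hj y hy x κ hx hxe).trans
        (mul_le_mul_of_nonneg_right hcBlo (by positivity))
  have hA' : ∀ j, j ≤ 1 → ∀ x ∈ Ω j, ∀ μ : Fin d,
      wt L η j * ‖A' x μ‖ ≤ cA ∧ wt L η j * ‖conjR (U₀ (x - e μ) μ)⁻¹ (A' (x - e μ) μ)‖ ≤ cA := fun j hj x hx μ =>
    ⟨(hA_of_datum (m := 0) hd2 hL1 hη hΩ hU₀ hcs0 h41 j hj x hx μ).1.trans hcAlo,
      (hA_of_datum (m := 0) hd2 hL1 hη hΩ hU₀ hcs0 h41 j hj x hx μ).2.trans hcAlo⟩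
  have hBu : ∀ (x : Site d) (κ : Fin d), expCfg (iEta η A') x κ ∈ unitaryUnits 𝔸 := expCfg_iEta_mem_unitaryUnits η hsa
  have hAx' : InAx L 1 (Λs 1) U₀ (mgauge U₀ 1 (expCfg (iEta η A')) * U₀) :=
    inAx_mgauge_expCfg_of_datum (m := 0) hd2 hL1 hΩ htower hone hWA1 (hAx 1 hk)
  have h129' : Restr129 L 1 (Λs 1) U₀ (1 : Site d → 𝔸ˣ) := B8Thm4TruncationLocal.restr129_one L 1 (Λs 1) U₀
  -- the source `D*A′` from the weight-free gradient bound `η²|∇A′| ≤ 2c⋆`: `|D*A′|₍₋₂₎ ≤ d·L²·2c⋆ ≤ cDA` at one level; Hermitian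
  have hgrad : ∀ j, j ≤ 0 → ∀ (y : Site d) (κ τ : Fin d), SideTouches (Ω j) y τ →
      ((L : ℝ) ^ j * η) ^ 2 * ‖covDerivFwd η U₀ κ (fun z => A' z τ) y‖ ≤ 2 * (5 * (d : ℝ) * L * B₀ * (α₀ + α₁)) := by
    intro j hj y κ τ _
    obtain rfl : j = 0 := Nat.le_zero.mp hj
    rw [pow_zero, one_mul]
    exact grad_bound_trivial hη hL1 hU₀ hcs0 h41 hA0 y κ τ
  have hcDAlo' : (d : ℝ) * (L : ℝ) ^ 2 * (2 * (5 * (d : ℝ) * L * B₀ * (α₀ + α₁))) ≤ cDA := by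
    have e : (d : ℝ) * (L : ℝ) ^ 2 * (2 * (5 * (d : ℝ) * L * B₀ * (α₀ + α₁))) = 2 * (d : ℝ) * (L : ℝ) ^ 2 * (5 * (d : ℝ) * L * B₀ * (α₀ + α₁)) := by
      ring
    rw [e]; exact hcDAlo
  have hDA : Bd2 L η 1 Ω (fun y => covDivB η U₀ A' y) cDA := fun j hj x hx =>
    (bd2_covDivB_of_grad (m := 0) hd2 hL1 hη hΩ hU₀ (by positivity) hgrad j hj x hx).trans hcDAlo'
  have hDAsa : ∀ j, j ≤ 1 → ∀ x ∈ Ω j, IsSelfAdjoint (covDivB η U₀ A' x) := fun j _ x _ => isSelfAdjoint_covDivB hU₀ hsa x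
  -- the JOIN's bond classes `Eb j := {b ∣ SideTouches (Ω j) b}` (§6)
  have hEbΩ : ∀ j, j ≤ 1 → ∀ x ∈ Ω j, ∀ μ : Fin d, (x, μ) ∈ {b : Site d × Fin d | SideTouches (Ω j) b.1 b.2} ∧
      (x - e μ, μ) ∈ {b : Site d × Fin d | SideTouches (Ω j) b.1 b.2} := fun j _ x hx μ => sideTouches_pair_of_mem hd2 hx μ
  have hEbT : ∀ j, j ≤ 1 → ∀ y ∈ Λs 1 j, ∀ (x : Site d) (κ : Fin d), InBox (tlo L y j) (thi L y j) x →
      InBox (tlo L y j) (thi L y j) (x + e κ) → (x, κ) ∈ {b : Site d × Fin d | SideTouches (Ω j) b.1 b.2} :=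
    fun j hj y hy x κ hx _ => sideTouches_of_tower_bond hd2 htower hj hy x κ hx
  -- THE JOIN WITH THE LAWS ON PRINT'S DOMAINS (`hFP_kLevel_of_sectE_local'_RD`, BY NAME) at `k := 1`, `Λs := Λs 1`, `u₁ := 1`, `B := iηA′`, `αP := α₀`
  obtain ⟨lam, hlsa, hloff, h108, ⟨μ, hmul⟩, h129''⟩ := hFP_kLevel_of_sectE_local'_RD (k := 1) (Λs := Λs 1)
    (Eb := fun j => {b : Site d × Fin d | SideTouches (Ω j) b.1 b.2}) (u₁ := (1 : Site d → 𝔸ˣ)) (A := A') hL hη hU₀ hEbΩ hEbT g Δ q qs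
    Aw c g_rightΩ c_range hΔ hqs hq H' hα₀ hα3 hα4 hcB0 hα₄pos hB₀'H hB₂' h33' h69' hd1 hα₀ hα3 hαP2 hBu hP' hAx' h129' hH0 hH1
    hH2 hHsupp hHequiv hQH hsmall hc₃ hsc hα₃' hs₁ hs₂ hs₃ hs₄ hs₅ hs₆ hs₇ hsm hprod8 hE_def hE₂_def lE_def lE₂_def hBG hBR hcA0 hcA' hcDA0
    ha₁' hb₁' hθ hG hGsupp hGreal hRbd hRreal hDA hDAsa hA' hsa h103 h106
  refine ⟨lam, hlsa, hloff, fun j hj b hb => h108 j hj b hb, ⟨μ, fun x hx => ?_⟩, h129''⟩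
  -- transport the multiplier clause from `A′` back to `A`: the two agree on the bonds read on `Ω₀`
  have hind : ((Ω 0).indicator fun y => covDivB η U₀ A y + covLap η U₀ lam y +
        ((conjR (gaugeExp lam y)⁻¹ (covDivB η U₀ A y) - covDivB η U₀ A y) +
          (gAd (covLap η U₀ lam y) (lam y) - covLap η U₀ lam y) + ∑ μ, frakF3 η U₀ lam A y μ)) =
      ((Ω 0).indicator fun y => covDivB η U₀ A' y + covLap η U₀ lam y +
        ((conjR (gaugeExp lam y)⁻¹ (covDivB η U₀ A' y) - covDivB η U₀ A' y) +
          (gAd (covLap η U₀ lam y) (lam y) - covLap η U₀ lam y) + ∑ μ, frakF3 η U₀ lam A' y μ)) := by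
    refine Set.indicator_congr fun y hy => ?_
    have h₁ : ∀ ν : Fin d, A' y ν = A y ν := fun ν => hagree 0 le_rfl y ν (sideTouches_pair_of_mem hd2 hy ν).1
    have h₂ : ∀ ν : Fin d, A' (y - e ν) ν = A (y - e ν) ν := fun ν => hagree 0 le_rfl (y - e ν) ν (sideTouches_pair_of_mem hd2 hy ν).2
    have h₃ : ∀ ν : Fin d, frakF3 η U₀ lam A' y ν = frakF3 η U₀ lam A y ν := fun ν => frakF3_congr_at η U₀ lam (h₁ ν) (h₂ ν)
    simp only [covDivB_congr_at η U₀ h₁ h₂, h₃]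
  rw [hind]
  exact hmul x hx

end Base

/-! ## §3 The sockets at ONE member from the letters socket ON PRINT'S DOMAINS, the b9 socket, the geometry laws and a windows family -/

section OneMember

variable {𝔸 : Type*} [CStarAlgebra 𝔸] [Nontrivial 𝔸]
variable {L : ℕ} {η : ℝ} {k : ℕ} {Ω : ℕ → Set (Site d)} {Λs : ℕ → ℕ → Set (Site d)} {Λb : ℕ → ℕ → Set (Site d × Fin d)}
  {B₀ B₀' B₀'H B₂' BG BR cB9 cL cP B₀β β : ℝ} {len : Site d → ℝ}

omit [Nontrivial 𝔸] in
/-- The range-form package `SockLettersR` (p462570; total inverse laws of `G′`) implies the package on print's domains `SockLettersRD`: drop `g_left`, evaluate `g_right`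
at the sites of `Ω₀`.  The converse is false in general (dag-ref-A W8′: the total laws fail at every member with finite `Ω₀` over `ℂ`). [cite: Balaban1985BackgroundPropagators, Thm 3.1 p.397] -/
theorem sockLettersRD_of_sockLettersR (h : SockLettersR (𝔸 := 𝔸) L BG BR B₀'H B₂' cL η k Ω Λs) : SockLettersRD (𝔸 := 𝔸) L BG BR B₀'H B₂' cL η k Ω Λs := by
  intro α₀ hα₀ hαP U₀ hU₀ hAk n hn hnk
  obtain ⟨g, Δ, q, qs, Aw, c, H', -, g_right, hrest⟩ := h α₀ hα₀ hαP U₀ hU₀ hAk n hn hnk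
  exact ⟨g, Δ, q, qs, Aw, c, H', fun x y _ => by rw [g_right], hrest⟩

omit [Nontrivial 𝔸] in
/-- The full-space package `SockLetters` (p454033) implies the package on print's domains `SockLettersRD` (via `SockLettersR`). [cite: Balaban1985BackgroundPropagators, Thm 3.1 p.397, (3.25) p.394] -/
theorem sockLettersRD_of_sockLetters (h : SockLetters (𝔸 := 𝔸) L BG BR B₀'H B₂' cL η k Ω Λs) : SockLettersRD (𝔸 := 𝔸) L BG BR B₀'H B₂' cL η k Ω Λs :=
  sockLettersRD_of_sockLettersR (sockLettersR_of_sockLetters h)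

/-- **`SockHFP` AT ONE MEMBER FROM THE [4]-LETTERS SOCKET ON PRINT'S DOMAINS** — Proposition 5's fixed point in plain currency for every level-`m` datum of Theorem 4's
induction (`1 ≤ m < k`), from: the letters socket `SockLettersRD … c_L …` (`B8SockLettersRD`; unpacked at the truncation `m + 1`, regularity `α₀ ≤ c_P ≤ c_L`), the b9 socket at level `m`
(`SB9all`), the member's `ZdIdx` laws (`Ω` antitone, `hbox`, `hclass`), towers inside `Ω_j` at every truncation (`htw`), index law №8 (`h8lt`, `h8top`), and a windows
family below `c_P` in the shape of `B8SockHFPWindows.hfpWindows_of_guard`; proof = `sockHFP_body_of_join_RD` at `c_B = c_A = L·c⋆`, `c_DA = 2dL²·c⋆`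
(`B8SockHFPOfSockLetters.sockHFP_of_sockLetters` verbatim on the socket `SockLettersRD`).
[cite: Balaban1985RegularSpaces, Prop. 5 (1.106)–(1.109) p.94, Thm 4 p.88, (1.67)–(1.69) p.88, p.89] -/
theorem sockHFP_of_sockLettersRD (hd2 : 2 ≤ d) (hL : 2 ≤ L) (hη : 0 < η) (hΩ : ∀ j, Ω (j + 1) ⊆ Ω j)
    (hbox : ∀ m, m ≤ k → ∀ j, j ≤ m → ∀ c ∈ Λb m j, ∀ x, InBox (loK L j c.1) (bondHiK L j c.1 c.2) x → x ∈ Ω j)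
    (hclass : ∀ m, m ≤ k → ∀ j, j ≤ m → ∀ c ∈ Λb m j,
      (c.1 ∈ Λs m j ∧ c.1 + e c.2 ∈ Λs m j) ∨
      (∃ j', j = j' + 1 ∧ (∀ x, (L : ℤ) • c.1 ≤ x → x ≤ (L : ℤ) • c.1 + blockTop L → x ∈ Λs m j') ∧ c.1 + e c.2 ∈ Λs m j) ∨
      (∃ j', j = j' + 1 ∧ c.1 ∈ Λs m j ∧ (∀ x, (L : ℤ) • (c.1 + e c.2) ≤ x → x ≤ (L : ℤ) • (c.1 + e c.2) + blockTop L → x ∈ Λs m j')))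
    (htw : ∀ m, m ≤ k → ∀ j, j ≤ m → ∀ y ∈ Λs m j, ∀ x, InBox (tlo L y j) (thi L y j) x → x ∈ Ω j)
    (h8lt : ∀ m, m < k → ∀ j, j < m → Λs m j = Λs (m + 1) j)
    (h8top : ∀ m, m < k → ∀ x, x ∈ Λs m m ↔ x ∈ Λs (m + 1) m ∨ ∃ y ∈ Λs (m + 1) (m + 1), x ∈ blockSites L y)
    (hB₀ : 0 < B₀) (hB₀' : 0 < B₀') (hB₀'H : 0 < B₀'H) (hB₂' : 0 ≤ B₂') (hBG : 0 ≤ BG) (hBR : 0 ≤ BR)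
    (SLet : SockLettersRD (𝔸 := 𝔸) L BG BR B₀'H B₂' cL η k Ω Λs)
    (SB9all : ∀ m, m ≤ k → SockB9P3 (𝔸 := 𝔸) L B₀ B₀β cB9 β len η m Ω Λs Λb) (hcPL : cP ≤ cL)
    (hwin : ∀ α₀ α₁ : ℝ, 0 < α₀ → 0 < α₁ → α₀ + α₁ ≤ cP →
      ∀ cs α₄ cB cDA hE hE₂ lE lE₂ : ℝ, cs = 5 * (d : ℝ) * L * B₀ * (α₀ + α₁) → α₄ = 8 * B₀' * (5 * (d : ℝ) * L * B₀) * (α₀ + α₁) →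
      cB = L * cs → cDA = 2 * (d : ℝ) * (L : ℝ) ^ 2 * cs →
      hE = B₀'H * (C2p d * (40 * d * cB + α₄) * α₄) → hE₂ = B₂' * (C2p d * (40 * d * cB + α₄) * α₄) →
      lE = B₀'H * (4 * C2p d * (40 * d * cB + 2 * α₄)) → lE₂ = B₂' * (4 * C2p d * (40 * d * cB + 2 * α₄)) →
      36 * d * B₀ * cs ≤ 1 / 2 ∧
      8 * (131072 * ((d : ℝ) + 1) ^ 2) * Real.exp (4 * (800 * ((d : ℝ) + 1) ^ 2 * ((d : ℝ) + 4)) * α₀) ≤ 16 * (131072 * ((d : ℝ) + 1) ^ 2) ∧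
      2 * cs ^ 2 + 20 * d * α₀ * cs + 2 * (16 * (131072 * ((d : ℝ) + 1) ^ 2)) * cs ^ 2 ≤ α₀ + α₁ ∧
      (d : ℝ) * L * α₁ ≤ 1 / 8 ∧
      α₀ ≤ cB9 ∧ cs ≤ cB9 ∧
      C0 d * α₀ ≤ 1 / 3 ∧ 4 * α₀ ≤ c2' d L ∧
      Real.exp (4 * (800 * ((d : ℝ) + 1) ^ 2 * ((d : ℝ) + 4)) * α₀) * (1 + 8 * (131072 * ((d : ℝ) + 1) ^ 2) * cB) ≤ 2 ∧
      2 * cB ≤ c3 d L ∧ 2048 * (d : ℝ) * cB ≤ 1 ∧ 40 * d * cB ≤ 1 / 200 ∧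
      200 * C6 d * (2 * α₄) ≤ 1 ∧ 12000 * ((d : ℝ) + 1) * L * (2 * α₄) ≤ 1 ∧
      C4G d L * (α₀ + 40 * d * cB + 4 * (2 * α₄)) ≤ 1 ∧
      1024 * ((d : ℝ) + 1) * ((d : ℝ) + 4) * L ^ 2 * α₀ ≤ 1 ∧ 32 * ((d : ℝ) + 1) ^ 2 * C6 d * L ^ 2 * α₀ ≤ 1 ∧
      16 * d * C5' d * C6 d * (L : ℝ) ^ 2 * α₀ ≤ 1 ∧ 8 * d * C6 d * L * α₀ ≤ 1 ∧
      40 * d * cB + α₄ ≤ 1 / (4 * B₀'H * (2 * C2p d)) ∧ 2 * C6 d * (40 * d * cB + 4 * α₄) ≤ 1 / 8 ∧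
      cB ≤ 1 / 13 ∧ α₄ / 4 + hE ≤ 1 / 24 ∧ α₄ / 4 + hE ≤ 1 / 140 ∧ 10 * (α₄ / 4 + hE) * BR ≤ 1 / 2 ∧
      BG * Mc d BR (α₄ / 4 + hE) cB hE₂ cDA ≤ α₄ / 4 ∧
      BG * Kc d BR (α₄ / 4 + hE) cB hE₂ cDA lE₂ (1 + lE) (1 + lE) ≤ 1 / 2) :
    SockHFP (𝔸 := 𝔸) L B₀ B₀' cP η k Ω Λs := by
  intro α₀ α₁ hα₀ hα₁ hs U₀ U' hU₀ hU' h33 h34 hAx h135 _ m hm1 hmk u₁ U₁ A hu₁ _ hW h129 hLan hdat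
  -- the windows at this (α₀, α₁)
  obtain ⟨hside, hC₂, h61, hsmall₁, hα₀9, hcs9, hα3, hα4, hsmall, hc₃, hsc, hα₃', hs₁, hs₂, hs₃, hs₄, hs₅, hs₆, hs₇, hsm, hprod8, hcA', ha₁',
    hb₁', hθ, h103, h106⟩ := hwin α₀ α₁ hα₀ hα₁ hs _ _ _ _ _ _ _ _ rfl rfl rfl rfl rfl rfl rfl rfl
  -- the letters at the truncation `m + 1`
  have hα₀L : α₀ ≤ cL := by linarith
  obtain ⟨g, Δ, q, qs, Aw, c, H', g_rightΩ, c_range, hΔ, hqs, hq, hH0, hH1, hH2, hHsupp, hHequiv, hQH, hG, hGsupp, hGreal, hRbd, hRreal⟩ :=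
    SLet α₀ hα₀ hα₀L U₀ hU₀ h33 (m + 1) (by omega) hmk
  have hcs0 : 0 ≤ 5 * (d : ℝ) * L * B₀ * (α₀ + α₁) := by
    have : 0 ≤ α₀ + α₁ := by linarith
    positivity
  have hcDAlo : (d : ℝ) * (L : ℝ) ^ 2 * (5 * (d : ℝ) * L * B₀ * (α₀ + α₁)) ≤ 2 * (d : ℝ) * (L : ℝ) ^ 2 * (5 * (d : ℝ) * L * B₀ * (α₀ + α₁)) := by
    have h := mul_nonneg (by positivity : (0 : ℝ) ≤ (d : ℝ) * (L : ℝ) ^ 2) hcs0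
    linarith only [h]
  exact sockHFP_body_of_join_RD hd2 hL hη hΩ hbox hclass hm1 hmk (htw (m + 1) hmk) (h8lt m hmk) (h8top m hmk) hα₀ hα₁ hB₀ hB₀' rfl rfl hU₀ hU'
    h33 h34 hAx h135 hu₁ hW h129 hLan hdat (SB9all m hmk.le) hα₀9 hcs9 hside hC₂ h61 hsmall₁ g Δ q qs Aw c g_rightΩ c_range hΔ hqs hq H'
    hB₀'H hB₂' hBG hBR hH0 hH1 hH2 hHsupp hHequiv hQH hG hGsupp hGreal hRbd hRreal le_rfl le_rfl hcDAlo hα3 hα4 hsmall hc₃ hsc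
    hα₃' hs₁ hs₂ hs₃ hs₄ hs₅ hs₆ hs₇ hsm hprod8 rfl rfl rfl rfl hcA' ha₁' hb₁' hθ h103 h106

/-- **`SockHFP₀` AT ONE MEMBER FROM THE [4]-LETTERS SOCKET ON PRINT'S DOMAINS** — the base datum (`u₁ = 1`, `U₁ = U′`, p. 89); the letters `SockLettersRD` at the
truncation `1`, towers of `Λs 1` inside `Ω_j`, the windows family below `c_P` (no b9 socket and no index law are read); proof = `sockHFP₀_body_of_join_RD`
(`B8SockHFPOfSockLetters.sockHFP₀_of_sockLetters` verbatim on the socket `SockLettersRD`).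
[cite: Balaban1985RegularSpaces, Prop. 5 (1.106)–(1.109) p.94, p.89 (the start of the induction)] -/
theorem sockHFP₀_of_sockLettersRD (hd2 : 2 ≤ d) (hL : 2 ≤ L) (hη : 0 < η) (hk : 1 ≤ k) (hΩ : ∀ j, Ω (j + 1) ⊆ Ω j)
    (htw : ∀ m, m ≤ k → ∀ j, j ≤ m → ∀ y ∈ Λs m j, ∀ x, InBox (tlo L y j) (thi L y j) x → x ∈ Ω j)
    (hB₀ : 0 < B₀) (hB₀' : 0 < B₀') (hB₀'H : 0 < B₀'H) (hB₂' : 0 ≤ B₂') (hBG : 0 ≤ BG) (hBR : 0 ≤ BR)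
    (SLet : SockLettersRD (𝔸 := 𝔸) L BG BR B₀'H B₂' cL η k Ω Λs) (hcPL : cP ≤ cL)
    (hwin : ∀ α₀ α₁ : ℝ, 0 < α₀ → 0 < α₁ → α₀ + α₁ ≤ cP →
      ∀ cs α₄ cB cDA hE hE₂ lE lE₂ : ℝ, cs = 5 * (d : ℝ) * L * B₀ * (α₀ + α₁) → α₄ = 8 * B₀' * (5 * (d : ℝ) * L * B₀) * (α₀ + α₁) →
      cB = L * cs → cDA = 2 * (d : ℝ) * (L : ℝ) ^ 2 * cs →
      hE = B₀'H * (C2p d * (40 * d * cB + α₄) * α₄) → hE₂ = B₂' * (C2p d * (40 * d * cB + α₄) * α₄) →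
      lE = B₀'H * (4 * C2p d * (40 * d * cB + 2 * α₄)) → lE₂ = B₂' * (4 * C2p d * (40 * d * cB + 2 * α₄)) →
      36 * d * B₀ * cs ≤ 1 / 2 ∧
      8 * (131072 * ((d : ℝ) + 1) ^ 2) * Real.exp (4 * (800 * ((d : ℝ) + 1) ^ 2 * ((d : ℝ) + 4)) * α₀) ≤ 16 * (131072 * ((d : ℝ) + 1) ^ 2) ∧
      2 * cs ^ 2 + 20 * d * α₀ * cs + 2 * (16 * (131072 * ((d : ℝ) + 1) ^ 2)) * cs ^ 2 ≤ α₀ + α₁ ∧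
      (d : ℝ) * L * α₁ ≤ 1 / 8 ∧
      α₀ ≤ cB9 ∧ cs ≤ cB9 ∧
      C0 d * α₀ ≤ 1 / 3 ∧ 4 * α₀ ≤ c2' d L ∧
      Real.exp (4 * (800 * ((d : ℝ) + 1) ^ 2 * ((d : ℝ) + 4)) * α₀) * (1 + 8 * (131072 * ((d : ℝ) + 1) ^ 2) * cB) ≤ 2 ∧
      2 * cB ≤ c3 d L ∧ 2048 * (d : ℝ) * cB ≤ 1 ∧ 40 * d * cB ≤ 1 / 200 ∧
      200 * C6 d * (2 * α₄) ≤ 1 ∧ 12000 * ((d : ℝ) + 1) * L * (2 * α₄) ≤ 1 ∧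
      C4G d L * (α₀ + 40 * d * cB + 4 * (2 * α₄)) ≤ 1 ∧
      1024 * ((d : ℝ) + 1) * ((d : ℝ) + 4) * L ^ 2 * α₀ ≤ 1 ∧ 32 * ((d : ℝ) + 1) ^ 2 * C6 d * L ^ 2 * α₀ ≤ 1 ∧
      16 * d * C5' d * C6 d * (L : ℝ) ^ 2 * α₀ ≤ 1 ∧ 8 * d * C6 d * L * α₀ ≤ 1 ∧
      40 * d * cB + α₄ ≤ 1 / (4 * B₀'H * (2 * C2p d)) ∧ 2 * C6 d * (40 * d * cB + 4 * α₄) ≤ 1 / 8 ∧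
      cB ≤ 1 / 13 ∧ α₄ / 4 + hE ≤ 1 / 24 ∧ α₄ / 4 + hE ≤ 1 / 140 ∧ 10 * (α₄ / 4 + hE) * BR ≤ 1 / 2 ∧
      BG * Mc d BR (α₄ / 4 + hE) cB hE₂ cDA ≤ α₄ / 4 ∧
      BG * Kc d BR (α₄ / 4 + hE) cB hE₂ cDA lE₂ (1 + lE) (1 + lE) ≤ 1 / 2) :
    SockHFP₀ (𝔸 := 𝔸) L B₀ B₀' cP η k Ω Λs := by
  intro α₀ α₁ hα₀ hα₁ hs U₀ U' hU₀ _ h33 h34 hAx _ _ A hdat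
  obtain ⟨-, -, -, -, -, -, hα3, hα4, hsmall, hc₃, hsc, hα₃', hs₁, hs₂, hs₃, hs₄, hs₅, hs₆, hs₇, hsm, hprod8, hcA', ha₁', hb₁', hθ, h103, h106⟩ :=
    hwin α₀ α₁ hα₀ hα₁ hs _ _ _ _ _ _ _ _ rfl rfl rfl rfl rfl rfl rfl rfl
  have hα₀L : α₀ ≤ cL := by linarith
  obtain ⟨g, Δ, q, qs, Aw, c, H', g_rightΩ, c_range, hΔ, hqs, hq, hH0, hH1, hH2, hHsupp, hHequiv, hQH, hG, hGsupp, hGreal, hRbd, hRreal⟩ :=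
    SLet α₀ hα₀ hα₀L U₀ hU₀ h33 1 le_rfl hk
  exact sockHFP₀_body_of_join_RD hd2 hL hη hk hΩ (htw 1 hk) hα₀ hα₁ hB₀ hB₀' rfl rfl hU₀ h33 h34 hAx hdat g Δ q qs Aw c g_rightΩ c_range hΔ
    hqs hq H' hB₀'H hB₂' hBG hBR hH0 hH1 hH2 hHsupp hHequiv hQH hG hGsupp hGreal hRbd hRreal le_rfl le_rfl le_rfl hα3 hα4 hsmall hc₃ hsc hα₃' hs₁
    hs₂ hs₃ hs₄ hs₅ hs₆ hs₇ hsm hprod8 rfl rfl rfl rfl hcA' ha₁' hb₁' hθ h103 h106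

end OneMember


/-! ## §4 ONE threshold for the whole family: `SockHFP₀` and `SockHFP` at every member from the letters socket ON PRINT'S DOMAINS and the b9 socket -/

section Threshold

variable {𝔸 : Type*} [CStarAlgebra 𝔸] [Nontrivial 𝔸]

/-- **THE PROPOSITION-5 SOCKETS OF THE N05 KNIT FROM THE [4]-LETTERS SOCKET ON PRINT'S DOMAINS, BELOW ONE THRESHOLD** (`B8SockHFPOfSockLetters.exists_threshold_sockHFP_pair`
verbatim on `SockLettersRD`; unlike the versions on `SockLetters`/`SockLettersR` this one has a letters hypothesis satisfiable at members with finite `Ω₀` — dag-ref-A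
W8/W8′) — for `d, L ≥ 2`, the knit's inputs `B₀, B₀′ > 0` with
`2 ≤ 5dLB₀`, [4]-letters constants `B₀′_H > 0`, `B₂′, B_G, B_R ≥ 0` with threshold `c_L > 0`, a b9 threshold `c_b9 > 0`, and the free-constant condition
`3·(2dL²)·B_G·B_R ≤ B₀′` (the socket's `B₀′` absorbs the `D*A`-term, p. 93), there is `c_F > 0` such that AT EVERY member (`η > 0`, `k ≥ 1`, `Ω` antitone, `Λs`, `Λb`
with the `ZdIdx` laws `hbox`/`hclass`, towers inside `Ω_j` AT EVERY TRUNCATION, INDEX LAW №8) the letters socket `SockLettersRD L B_G B_R B₀′_H B₂′ c_L η k Ω Λs` and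
the b9 socket at every truncation give `SockHFP₀ L B₀ B₀′ c_F η k Ω Λs` AND `SockHFP L B₀ B₀′ c_F η k Ω Λs` (`c_F = min(c_P, c_L)`, `c_P` of
`B8SockHFPWindows.hfpWindows_of_guard`).  This is Theorem 4's «there exists a constant c₁» with the Proposition-5 socket served by [4]'s letters.
[cite: Balaban1985RegularSpaces, Prop. 5 (1.106)–(1.109) p.94, Thm 4 p.88 («there exists a constant c₁»), (1.102)–(1.103) p.93, p.89] -/
theorem exists_threshold_sockHFP_pairRD (hd2 : 2 ≤ d) {L : ℕ} (hL : 2 ≤ L) {B₀ B₀' B₀'H B₂' BG BR cB9 cL : ℝ} (hB₀ : 0 < B₀) (hB₀' : 0 < B₀')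
    (hB : 2 ≤ 5 * (d : ℝ) * L * B₀) (hB₀'H : 0 < B₀'H) (hB₂' : 0 ≤ B₂') (hBG : 0 ≤ BG) (hBR : 0 ≤ BR) (hcB9 : 0 < cB9) (hcL : 0 < cL)
    (hfree : 3 * (2 * (d : ℝ) * (L : ℝ) ^ 2) * BG * BR ≤ B₀') :
    ∃ cF : ℝ, 0 < cF ∧ ∀ {η : ℝ}, 0 < η → ∀ {k : ℕ}, 1 ≤ k → ∀ {Ω : ℕ → Set (Site d)}, (∀ j, Ω (j + 1) ⊆ Ω j) →
      ∀ {Λs : ℕ → ℕ → Set (Site d)} {Λb : ℕ → ℕ → Set (Site d × Fin d)},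
      (∀ m, m ≤ k → ∀ j, j ≤ m → ∀ c ∈ Λb m j, ∀ x, InBox (loK L j c.1) (bondHiK L j c.1 c.2) x → x ∈ Ω j) →
      (∀ m, m ≤ k → ∀ j, j ≤ m → ∀ c ∈ Λb m j,
        (c.1 ∈ Λs m j ∧ c.1 + e c.2 ∈ Λs m j) ∨
        (∃ j', j = j' + 1 ∧ (∀ x, (L : ℤ) • c.1 ≤ x → x ≤ (L : ℤ) • c.1 + blockTop L → x ∈ Λs m j') ∧ c.1 + e c.2 ∈ Λs m j) ∨
        (∃ j', j = j' + 1 ∧ c.1 ∈ Λs m j ∧ (∀ x, (L : ℤ) • (c.1 + e c.2) ≤ x → x ≤ (L : ℤ) • (c.1 + e c.2) + blockTop L → x ∈ Λs m j'))) →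
      (∀ m, m ≤ k → ∀ j, j ≤ m → ∀ y ∈ Λs m j, ∀ x, InBox (tlo L y j) (thi L y j) x → x ∈ Ω j) →
      (∀ m, m < k → ∀ j, j < m → Λs m j = Λs (m + 1) j) →
      (∀ m, m < k → ∀ x, x ∈ Λs m m ↔ x ∈ Λs (m + 1) m ∨ ∃ y ∈ Λs (m + 1) (m + 1), x ∈ blockSites L y) →
      ∀ {B₀β β : ℝ} {len : Site d → ℝ},
      SockLettersRD (𝔸 := 𝔸) L BG BR B₀'H B₂' cL η k Ω Λs → (∀ m, m ≤ k → SockB9P3 (𝔸 := 𝔸) L B₀ B₀β cB9 β len η m Ω Λs Λb) →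
        SockHFP₀ (𝔸 := 𝔸) L B₀ B₀' cF η k Ω Λs ∧ SockHFP (𝔸 := 𝔸) L B₀ B₀' cF η k Ω Λs := by
  have hd1 : 1 ≤ d := le_trans (by norm_num) hd2
  have hL1 : 1 ≤ L := le_trans (by norm_num) hL
  obtain ⟨cP, hcP, hwin⟩ := hfpWindows_of_guard hd1 hL1 hB₀ hB₀' hB hB₀'H hB₂' hBG hBR hcB9 hfree
  refine ⟨min cP cL, lt_min hcP hcL, ?_⟩
  intro η hη k hk Ω hΩ Λs Λb hbox hclass htw h8lt h8top B₀β β len SLet SB9all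
  have hwin' : ∀ α₀ α₁ : ℝ, 0 < α₀ → 0 < α₁ → α₀ + α₁ ≤ min cP cL → _ :=
    fun α₀ α₁ hα₀ hα₁ hs => hwin α₀ α₁ hα₀ hα₁ (hs.trans (min_le_left _ _))
  exact ⟨sockHFP₀_of_sockLettersRD hd2 hL hη hk hΩ htw hB₀ hB₀' hB₀'H hB₂' hBG hBR SLet (min_le_right _ _) hwin',
    sockHFP_of_sockLettersRD hd2 hL hη hΩ hbox hclass htw h8lt h8top hB₀ hB₀' hB₀'H hB₂' hBG hBR SLet SB9all (min_le_right _ _) hwin'⟩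


end Threshold

#print axioms exists_threshold_sockHFP_pairRD

end Literature.MathematicalPhysics.QuantumFieldTheory.Balaban1983to89.B8SockHFPRD

end
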